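import Summits.MatrixMultiplication.OmegaCensus.STPP222CubeFrom46

/-!
# ω-census, `(1,2,2)¹⁴` WINDOW law «order in [284, 289]»: the window domination core, block I (kernel)

HONEST FRAMING (pub-omega census; verbatim): lottery ticket; floor = certified bounds/negative ranges.
Census STRUCTURE bookkeeping of the STPP track (seat pub-omega-stpp-3, gen 28; STRUCTURE row B5, column `T2`, §2 C10 row 14), not progress on `ω`:
small patterns in small groups bound no exponent.

Data of the window law `STPPSmallPatternT2K14W284Law.lean` for the generic window bridge `STPPSmallPatternLawBridgeWindow.lean`: the 77 prime powers
`≤ 283`, caps for the threshold `284` (`2 ↦ 9`, `3 ↦ 6`, `4 ↦ 5`, `5 ↦ 4`, `7 ↦ 3`, `8 ↦ 3`, `9 ↦ 3`, `11 ↦ 3`, `13 ↦ 3`, `16 ↦ 3`, else `2`), cap lists `(PP.filter (· ∣ E)).map (w ↦ (w, cap w))` written out, and kernel decisions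
«every capped multiset with product in `[284, 289]` that is MINIMAL for «product `≥ 284`» (`∀ x ∈ M, M.prod < 284·x`) dominates one of the 15 window
seed types (the seed types of the `284` plan of order `≤ 289`)» (E 280–283).  444813 capped multisets over `E ≤ 283` are enumerated in all; the statement is
checked independently in Python, 0 exceptions (HOME `pub-omega-stpp-3-g28/code/k28/mk_window.py`).

References: H. Cohn, R. Kleinberg, B. Szegedy, C. Umans, FOCS 2005 (arXiv:math/0511460), Def. 5.1.
-/

namespace Summit.MatrixMultiplication.OmegaCensus

set_option maxHeartbeats 0 in
set_option maxRecDepth 20000 in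
/-- Window domination core (minimal capped multisets with product in `[284, 289]`), exponents `280 ≤ E ≤ 283` (5016 capped multisets enumerated; kernel). -/
theorem t2k14w284Core_280_283 : ∀ E ∈ List.range' 280 4, ∀ M ∈ subMS ((fun E => (([2, 3, 4, 5, 7, 8, 9, 11, 13, 16, 17, 19, 23, 25, 27, 29, 31, 32, 37, 41, 43, 47, 49, 53, 59, 61, 64, 67, 71, 73, 79, 81, 83, 89, 97, 101, 103, 107, 109, 113, 121, 125, 127, 128, 131, 137, 139, 149, 151, 157, 163, 167, 169, 173, 179, 181, 191, 193, 197, 199, 211, 223, 227, 229, 233, 239, 241, 243, 251, 256, 257, 263, 269, 271, 277, 281, 283] : List ℕ).filter (· ∣ E)).map fun w => (w, (fun v => if v = 2 then 9 else if v = 3 then 6 else if v = 4 then 5 else if v = 5 then 4 else if v = 7 then 3 else if v = 8 then 3 else if v = 9 then 3 else if v = 11 then 3 else if v = 13 then 3 else if v = 16 then 3 else 2) w)) E), 284 ≤ M.prod → M.prod ≤ 289 → (∀ x ∈ M, M.prod < 284 * x) →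
    ∃ s ∈ ([[17, 17], [71, 2, 2], [9, 8, 4], [16, 9, 2], [32, 3, 3], [8, 4, 3, 3], [9, 4, 4, 2], [9, 8, 2, 2], [16, 3, 3, 2], [4, 4, 3, 3, 2], [8, 3, 3, 2, 2], [9, 4, 2, 2, 2], [4, 3, 3, 2, 2, 2], [9, 2, 2, 2, 2, 2], [3, 3, 2, 2, 2, 2, 2]] : List (List ℕ)), dom s M = true := by
  decide +kernel

end Summit.MatrixMultiplication.OmegaCensus
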